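import Summits.BirchSwinnertonDyer.BirchSwinnertonDyer.Theorems.ResidualThetaTransportAtTwoResidualSignedLambdaLowerCMAtTwoRhoLayerPairingTower
import Summits.BirchSwinnertonDyer.BirchSwinnertonDyer.Theorems.ResidualThetaTransportAtTwoResidualSignedLambdaLowerCMAtTwoCofreeLevelwiseKonig
import Literature.NumberTheory.GaloisRepresentations.ContinuousShapiroLiftCupAdjoint
import Literature.AnabelianGeometry.AbsoluteAnabelian.AbsAnabProp121viiLevelCompatProofs
import Literature.NumberTheory.EllipticCurves.LocalWeilPairingDuality
import HarnessLib

/-!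
# (T1), cohomological half: the MIXED projection formula `⟨[p]_* b', y⟩_{n,p^k} ↔ ⟨b', ι_* y⟩_{n,p^{k+1}}` for the layer Tate pairings of the
# torsion tower `A_ρ[p^k]`, in the value currency `t ↦ t.val • p^{-k}` of the S₀-frame

Route `ResidualThetaTransportAtTwo` (RTT), crux RSL_g `ResidualSignedLambdaLowerCMAtTwo` (stmt-BirchSwinnertonDyer-22608), stub S4₀ `stub_deepHalfAwayTwo`;
seat `prover-bsd-wall-tp2-p2x` g19 (`--supports 22608 --as helper`, closes nothing). THEOREMS ONLY (no definition, no named fact, no instance,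
no notation, no `sorry`). BSD is not proved by any of this; RSL_g is not proved here.

WHY. The assembly `AwayAssembly.exists_iwasawaH1_locdS_eq_of_towerCompat` (p704576) leaves the tower compatibility (T1) of the character-built
local classes along `[2] : A_ρ[2^{k+1}] → A_ρ[2^k]`. The characters are read on `H¹(U_{n,w}, A_ρ[2^k]|)` through `j_{n,k}`, and `j_{n,k+1} ∘ ι_* = j_{n,k}`
for the INCLUSION `ι : A_ρ[2^k] ↪ A_ρ[2^{k+1}]`, the adjoint of `[2]` under the pairings (`e_{k+1}(x, ι y) = e_k([2] x, y)`); so (T1) rests on the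
mixed projection formula proved here. The morphisms `ι` and `μ_{p^k} ↪ μ_{p^{k+1}}` enter as HYPOTHESES (`ι` with `hι : ↑(ι a) = ↑a`, `γ` with
`hγ : muVal (γ x) = muVal x`), so this file does not wait on the definition file `…CofreeTorsionIncl` (p705712, review queue) that names them.

* §1 `val_smul_inv_eq_coe_div`, **`invAt_cohomologyMap_incl_val_smul`** — THE invariant maps along `μ_{p^k} ↪ μ_{p^{k+1}}` in the value currency:
  `(inv_{p^{k+1}}(γ_* C)).val • p^{-(k+1)} = (inv_{p^k} C).val • p^{-k}` (`Prop121vii.invariantMap_muInclHom_compat_addCircle` transported along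
  `muLocalIso`, as TP2's `invAt_cohomologyMap_muLocalPow`).
* §2 `ePk_nsmul_right`, `ePk_incl_of_tower` (the module identity `e_{k+1}(x, ι y) = e_k([p] x, y)` from `htower` and `[p]` onto),
  **`cupProduct_layerSumPairingOf_incl`** (`γ_*([p]_* a ∪_{Σe_k} b) = a ∪_{Σe_{k+1}} ι_* b`, `ContPairing.cupProduct_coindFin_map_adjoint`).
* §3 **`layerPairingH1Of_pow_incl_val_smul`** — `(⟨[p]_* b', y⟩_{n,p^k}).val • p^{-k} = (⟨b', ι_* y⟩_{n,p^{k+1}}).val • p^{-(k+1)}`.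
* The `p = 2` consequences in the S₀-frame (`[2]_* b₁ = b₀` for character-built layer classes, and the hypothesis `hT1` of p704576) are in the sequel
  `…DeepHalfAwayTwoTowerPowTwo`.

References: [NeukirchSchmidtWingberg2008] I §4 (1.4.2), I §6 (1.6.4); [SerreLocalFields1979] XIII §3; [Kato2004Asterisque] §13.8; [PerrinRiou1994Invent] §3.6.1.
-/

set_option autoImplicit false
-- the Theorems namespace of this sub repeats the summit name by design (D-0017 nested layout)
set_option linter.dupNamespace false

noncomputable section

open scoped Classical

namespace Summit.BirchSwinnertonDyer.BirchSwinnertonDyer.Theorems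

namespace ThetaTransport.AwayTowerPow

open CategoryTheory Function Field NumberField IsDedekindDomain
  Literature.NumberTheory.EllipticCurves Literature.NumberTheory.EllipticCurves.CyclotomicLayer
  Literature.NumberTheory.EllipticCurves.GreenbergSelmer
  Literature.NumberTheory.GaloisRepresentations Literature.NumberTheory.GaloisRepresentations.DiscreteGaloisModule
  Literature.NumberTheory.GaloisCohomology ZpExtension Literature.AnabelianGeometry.AbsoluteAnabelian

/-! ## §1 THE invariant maps along the inclusion `μ_{p^k} ↪ μ_{p^{k+1}}`, in the value currency -/

section Inv

variable {p : ℕ} [Fact p.Prime] (v : HeightOneSpectrum (𝓞 ℚ)) (k : ℕ)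

/-- `m • N⁻¹ = m/N` in `ℚ/ℤ`. [cite: Kato2004Asterisque, §17.13 (p. 279)] -/
theorem val_smul_inv_eq_coe_div (m N : ℕ) :
    m • ((((N : ℚ))⁻¹ : ℚ) : AddCircle (1 : ℚ)) = ((((m : ℚ) / N : ℚ)) : AddCircle (1 : ℚ)) := by
  rw [← AddCircle.coe_nsmul, nsmul_eq_mul, div_eq_mul_inv]

/-- **THE invariant maps are compatible along `μ_{p^k} ↪ μ_{p^{k+1}}`, value currency**: for a morphism `γ : μ_{p^k}|_{Γ_v} ⟶ μ_{p^{k+1}}|_{Γ_v}`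
which is the inclusion on underlying units (`hγ`) and `C ∈ H²(Γ_v, μ_{p^k}|)`,
`(inv^{(p^{k+1})}(γ_* C)).val • p^{-(k+1)} = (inv^{(p^k)}(C)).val • p^{-k}` in `ℚ/ℤ` (the tree's `invariantMap_muInclHom_compat_addCircle` for `ℚ_v`,
transported along `μ(ℚ̄)| ≅ μ(ℚ̄_v)`). [cite: SerreLocalFields1979, XIII §3 (Prop. 6–7)] [cite: MochizukiAbsAnab2004, Prop 1.2.1 (vii) p.11] -/
theorem invAt_cohomologyMap_incl_val_smul (γ : muLocalRep (p ^ k) v ⟶ muLocalRep (p ^ (k + 1)) v)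
    (hγ : ∀ x : MuCarrier ℚ (p ^ k),
      haveI : NeZero (p ^ k) := ⟨pow_ne_zero k (Fact.out : p.Prime).ne_zero⟩
      haveI : NeZero (p ^ (k + 1)) := ⟨pow_ne_zero (k + 1) (Fact.out : p.Prime).ne_zero⟩
      muVal ℚ (p ^ (k + 1)) (γ.hom x) = muVal ℚ (p ^ k) x)
    (C : continuousCohomology 2 (muLocalRep (p ^ k) v)) :
    haveI : NeZero (p ^ k) := ⟨pow_ne_zero k (Fact.out : p.Prime).ne_zero⟩
    haveI : NeZero (p ^ (k + 1)) := ⟨pow_ne_zero (k + 1) (Fact.out : p.Prime).ne_zero⟩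
    (invAt (p ^ (k + 1)) v (cohomologyMap γ 2 C)).val • ((((p : ℚ) ^ (k + 1))⁻¹ : ℚ) : AddCircle (1 : ℚ)) =
      (invAt (p ^ k) v C).val • ((((p : ℚ) ^ k)⁻¹ : ℚ) : AddCircle (1 : ℚ)) := by
  haveI : NeZero (p ^ k) := ⟨pow_ne_zero k (Fact.out : p.Prime).ne_zero⟩
  haveI : NeZero (p ^ (k + 1)) := ⟨pow_ne_zero (k + 1) (Fact.out : p.Prime).ne_zero⟩
  have hdvd : p ^ k ∣ p ^ (k + 1) := Dvd.intro p (SignedKatoOffTwo.LayerPairing.pow_mul_prime_eq k)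
  -- swap `μ(ℚ̄)| ≅ μ(ℚ̄_v)` and the inclusions BEFORE `CharZero ℚ_v` is in context
  have hpt : ∀ x : MuCarrier ℚ (p ^ k),
      (resIdHom (γ ≫ (muLocalIso v (p ^ (k + 1))).hom)).hom x =
        (resIdHom (muInclHom (v.adicCompletion ℚ) hdvd)).hom ((resIdHom (muLocalIso v (p ^ k)).hom).hom x) := fun x => by
    apply muVal_injective (v.adicCompletion ℚ) (p ^ (k + 1))
    change muVal (v.adicCompletion ℚ) (p ^ (k + 1)) (muTransfer ℚ (v.adicCompletion ℚ) (p ^ (k + 1)) (γ.hom x)) =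
      muVal (v.adicCompletion ℚ) (p ^ (k + 1)) (muInclusion (v.adicCompletion ℚ) hdvd (muTransfer ℚ (v.adicCompletion ℚ) (p ^ k) x))
    rw [muVal_muTransfer, muVal_muInclusion, muVal_muTransfer, hγ]
  have h1 := map_comp_apply_of (ContinuousMonoidHom.id _) (ContinuousMonoidHom.id _) (ContinuousMonoidHom.id _) (fun _ => rfl)
    (resIdHom γ) (resIdHom (muLocalIso v (p ^ (k + 1))).hom) (resIdHom (γ ≫ (muLocalIso v (p ^ (k + 1))).hom)) (fun _ => rfl) 2 C
  have h2 := map_comp_apply_of (ContinuousMonoidHom.id _) (ContinuousMonoidHom.id _) (ContinuousMonoidHom.id _) (fun _ => rfl)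
    (resIdHom (muLocalIso v (p ^ k)).hom) (resIdHom (muInclHom (v.adicCompletion ℚ) hdvd))
    (resIdHom (γ ≫ (muLocalIso v (p ^ (k + 1))).hom)) hpt 2 C
  have hswap : (cohomologyMap (muLocalIso v (p ^ (k + 1))).hom 2).hom (cohomologyMap γ 2 C) =
      cohomologyMap (muInclHom (v.adicCompletion ℚ) hdvd) 2 ((cohomologyMap (muLocalIso v (p ^ k)).hom 2).hom C) :=
    h1.symm.trans h2
  haveI : CharZero (v.adicCompletion ℚ) := charZero_adicCompletion v
  haveI : Finite (MuCarrier (v.adicCompletion ℚ) (p ^ k)) := Literature.NumberTheory.EllipticCurves.finite_muCarrier (p ^ k) (v.adicCompletion ℚ)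
  haveI : Finite (MuCarrier (v.adicCompletion ℚ) (p ^ (k + 1))) := Literature.NumberTheory.EllipticCurves.finite_muCarrier (p ^ (k + 1)) (v.adicCompletion ℚ)
  have key := Prop121vii.invariantMap_muInclHom_compat_addCircle (v.adicCompletion ℚ) hdvd
    (Prop121vii.invLevel (v.adicCompletion ℚ) (p ^ k)) (Prop121vii.invLevel (v.adicCompletion ℚ) (p ^ (k + 1)))
    (Prop121vii.isInvariantMap_invLevel (v.adicCompletion ℚ) (p ^ k)) (Prop121vii.isInvariantMap_invLevel (v.adicCompletion ℚ) (p ^ (k + 1)))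
    ((cohomologyMap (muLocalIso v (p ^ k)).hom 2).hom C)
  rw [← hswap] at key
  unfold CyclotomicLayer.invAt localInvariantMap
  change (Prop121vii.invLevel (v.adicCompletion ℚ) (p ^ (k + 1))
      ((cohomologyMap (muLocalIso v (p ^ (k + 1))).hom 2).hom (cohomologyMap γ 2 C))).val • _ =
    (Prop121vii.invLevel (v.adicCompletion ℚ) (p ^ k) ((cohomologyMap (muLocalIso v (p ^ k)).hom 2).hom C)).val • _
  have e1 : ((((p : ℚ) ^ (k + 1))⁻¹ : ℚ) : AddCircle (1 : ℚ)) = (((((p ^ (k + 1) : ℕ) : ℚ))⁻¹ : ℚ) : AddCircle (1 : ℚ)) := by push_cast; rfl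
  have e2 : ((((p : ℚ) ^ k)⁻¹ : ℚ) : AddCircle (1 : ℚ)) = (((((p ^ k : ℕ) : ℚ))⁻¹ : ℚ) : AddCircle (1 : ℚ)) := by push_cast; rfl
  rw [e1, e2, val_smul_inv_eq_coe_div, val_smul_inv_eq_coe_div]
  exact key

end Inv

/-! ## §2 The module identity `e_{k+1}(x, ι y) = e_k([p] x, y)` and the mixed naturality of the summed cup products -/

section Cup

variable {p : ℕ} [Fact p.Prime] (S : Set (PadicAlgCl p)) {d : ℕ} (ρ : FramedGaloisRep ℚ ↥(padicCoeffIntegers S) d)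
  (ePk : ∀ k : ℕ, ↥(AddSubgroup.torsionBy (Cofree ρ ↥(padicCoeffField S)) ((p ^ k : ℕ) : ℤ)) →
    ↥(AddSubgroup.torsionBy (Cofree ρ ↥(padicCoeffField S)) ((p ^ k : ℕ) : ℤ)) → AlgebraicClosure ℚ)
  (hμPk : ∀ k a b, ePk k a b ^ (p ^ k) = 1)
  (hadd₁Pk : ∀ k a₁ a₂ b, ePk k (a₁ + a₂) b = ePk k a₁ b * ePk k a₂ b)
  (hadd₂Pk : ∀ k a b₁ b₂, ePk k a (b₁ + b₂) = ePk k a b₁ * ePk k a b₂)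
  (hgalPk : ∀ k (σ : absoluteGaloisGroup ℚ) (a b : ↥(AddSubgroup.torsionBy (Cofree ρ ↥(padicCoeffField S)) ((p ^ k : ℕ) : ℤ))),
    σ • ePk k a b = ePk k (cofreeTorsionGaloisModule S ρ _ σ a) (cofreeTorsionGaloisModule S ρ _ σ b))
  (htower : ∀ k (a b : ↥(AddSubgroup.torsionBy (Cofree ρ ↥(padicCoeffField S)) ((p ^ (k + 1) : ℕ) : ℤ))),
    ePk k ((cofreeTorsionPow S ρ k).hom a) ((cofreeTorsionPow S ρ k).hom b) = ePk (k + 1) a b ^ p)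
  (k : ℕ)
  (ι : (cofreeTorsionGaloisModule S ρ ((p ^ k : ℕ) : ℤ)).toTopRep ⟶ (cofreeTorsionGaloisModule S ρ ((p ^ (k + 1) : ℕ) : ℤ)).toTopRep)
  (hι : ∀ a : ↥(AddSubgroup.torsionBy (Cofree ρ ↥(padicCoeffField S)) ((p ^ k : ℕ) : ℤ)),
    ((ι.hom a : ↥(AddSubgroup.torsionBy (Cofree ρ ↥(padicCoeffField S)) ((p ^ (k + 1) : ℕ) : ℤ))) : Cofree ρ ↥(padicCoeffField S)) =
      (a : Cofree ρ ↥(padicCoeffField S)))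

include hμPk hadd₂Pk in
/-- `e_k(x, n • y) = e_k(x, y)^n` (`e_k(x, 0) = 1` since `e_k(x,0)² = e_k(x,0) ≠ 0`). [cite: SilvermanAEC2009, Prop. III.8.1] -/
theorem ePk_nsmul_right (j : ℕ) (x y : ↥(AddSubgroup.torsionBy (Cofree ρ ↥(padicCoeffField S)) ((p ^ j : ℕ) : ℤ))) (n : ℕ) :
    ePk j x (n • y) = ePk j x y ^ n := by
  have h0 : ePk j x 0 = 1 := by
    have hne : ePk j x 0 ≠ 0 := fun h => by
      have := hμPk j x 0
      rw [h, zero_pow (pow_ne_zero j (Fact.out : p.Prime).ne_zero)] at this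
      exact zero_ne_one this
    have hsq : ePk j x 0 * ePk j x 0 = ePk j x 0 := by rw [← hadd₂Pk, add_zero]
    exact (mul_eq_left₀ hne).mp hsq
  induction n with
  | zero => rw [zero_smul, pow_zero, h0]
  | succ n ih => rw [succ_nsmul, hadd₂Pk, ih, pow_succ]

include htower hμPk hadd₂Pk hι in
/-- **The module identity `e_{k+1}(x, ι y) = e_k([p] x, y)`** (`x ∈ A_ρ[p^{k+1}]`, `y ∈ A_ρ[p^k]`): write `y = [p] y₀` (`[p]` is onto, `cofreeTorsionPow_surjective`),
so `ι y = p • y₀` and both sides are `e_{k+1}(x, y₀)^p` (`htower`). [cite: SilvermanAEC2009, Prop. III.8.1 (e)] [cite: Kato2004Asterisque, §13.8 (p. 228)] -/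
theorem ePk_incl_of_tower (x : ↥(AddSubgroup.torsionBy (Cofree ρ ↥(padicCoeffField S)) ((p ^ (k + 1) : ℕ) : ℤ)))
    (y : ↥(AddSubgroup.torsionBy (Cofree ρ ↥(padicCoeffField S)) ((p ^ k : ℕ) : ℤ))) :
    ePk (k + 1) x (ι.hom y) = ePk k ((cofreeTorsionPow S ρ k).hom x) y := by
  obtain ⟨y₀, rfl⟩ := CofreeLevelwiseKonig.cofreeTorsionPow_surjective S ρ k y
  have hιy : ι.hom ((cofreeTorsionPow S ρ k).hom y₀) = (p : ℕ) • y₀ := by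
    apply Subtype.ext
    rw [hι, coe_cofreeTorsionPow_apply, AddSubgroupClass.coe_nsmul, natCast_zsmul]
  rw [hιy, ePk_nsmul_right S ρ ePk hμPk hadd₂Pk (k + 1) x y₀ p, htower]

variable (v : HeightOneSpectrum (𝓞 ℚ))
  (γ : muLocalRep (p ^ k) v ⟶ muLocalRep (p ^ (k + 1)) v)
  (hγ : ∀ x : MuCarrier ℚ (p ^ k),
    haveI : NeZero (p ^ k) := ⟨pow_ne_zero k (Fact.out : p.Prime).ne_zero⟩
    haveI : NeZero (p ^ (k + 1)) := ⟨pow_ne_zero (k + 1) (Fact.out : p.Prime).ne_zero⟩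
    muVal ℚ (p ^ (k + 1)) (γ.hom x) = muVal ℚ (p ^ k) x)

include htower hμPk hadd₂Pk hι hγ in
/-- The module identity read on the carriers `μ` through `γ`: `γ(⟨[p] x, y⟩_{e_k}) = ⟨x, ι y⟩_{e_{k+1}}` for the LOCAL pairings `localPairingOfFun`.
[cite: NeukirchSchmidtWingberg2008, I §4 (1.4.2)] -/
theorem incl_localPairingOfFun (x : ↥(AddSubgroup.torsionBy (Cofree ρ ↥(padicCoeffField S)) ((p ^ (k + 1) : ℕ) : ℤ)))
    (y : ↥(AddSubgroup.torsionBy (Cofree ρ ↥(padicCoeffField S)) ((p ^ k : ℕ) : ℤ))) :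
    haveI : NeZero (p ^ k) := ⟨pow_ne_zero k (Fact.out : p.Prime).ne_zero⟩
    haveI : NeZero (p ^ (k + 1)) := ⟨pow_ne_zero (k + 1) (Fact.out : p.Prime).ne_zero⟩
    γ.hom ((localPairingOfFun (cofreeTorsionGaloisModule S ρ ((p ^ k : ℕ) : ℤ)) (p ^ k) (ePk k) (hμPk k) (hadd₁Pk k) (hadd₂Pk k)
        (hgalPk k) v).toLin ((cofreeTorsionLocalPow S ρ k v).hom x) y) =
      (localPairingOfFun (cofreeTorsionGaloisModule S ρ ((p ^ (k + 1) : ℕ) : ℤ)) (p ^ (k + 1)) (ePk (k + 1)) (hμPk (k + 1))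
          (hadd₁Pk (k + 1)) (hadd₂Pk (k + 1)) (hgalPk (k + 1)) v).toLin x
        ((TopRep.ofHom (ι.hom.restrictField (v.adicCompletion ℚ)) :
          localRepOf (cofreeTorsionGaloisModule S ρ ((p ^ k : ℕ) : ℤ)) v ⟶ localRepOf (cofreeTorsionGaloisModule S ρ ((p ^ (k + 1) : ℕ) : ℤ)) v).hom y) := by
  haveI : NeZero (p ^ k) := ⟨pow_ne_zero k (Fact.out : p.Prime).ne_zero⟩
  haveI : NeZero (p ^ (k + 1)) := ⟨pow_ne_zero (k + 1) (Fact.out : p.Prime).ne_zero⟩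
  apply muVal_injective ℚ (p ^ (k + 1))
  apply Units.ext
  rw [hγ, localPairingOfFun_toLin_apply, localPairingOfFun_toLin_apply]
  change (((DiscreteGaloisModule.MuCarrier.toAdditive (pairingHomOfFun (p ^ k) (ePk k) (hμPk k) (hadd₁Pk k) (hadd₂Pk k)
      ((cofreeTorsionPow S ρ k).hom x) y)).toMul : (AlgebraicClosure ℚ)ˣ) : AlgebraicClosure ℚ) =
    (((DiscreteGaloisModule.MuCarrier.toAdditive (pairingHomOfFun (p ^ (k + 1)) (ePk (k + 1)) (hμPk (k + 1)) (hadd₁Pk (k + 1))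
      (hadd₂Pk (k + 1)) x (ι.hom y))).toMul : (AlgebraicClosure ℚ)ˣ) : AlgebraicClosure ℚ)
  rw [coe_pairingHomOfFun, coe_pairingHomOfFun]
  exact (ePk_incl_of_tower S ρ ePk hμPk hadd₂Pk htower k ι hι x y).symm

variable (κ : ZpExtension ℚ p)

include htower hμPk hadd₂Pk hι hγ in
/-- **Mixed naturality of the summed cup products along `([p], ι)`**: `γ_*([p]_* a ∪_{Σe_k} b) = a ∪_{Σe_{k+1}} ι_* b` on
`H¹(Γ_v, Maps(Γ_v ⧸ U_n, A_ρ[p^{k+1}]|)) × H¹(Γ_v, Maps(Γ_v ⧸ U_n, A_ρ[p^k]|))` (`ContPairing.cupProduct_coindFin_map_adjoint`).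
[cite: NeukirchSchmidtWingberg2008, I §4 (1.4.2)] -/
theorem cupProduct_layerSumPairingOf_incl [CompactSpace (absoluteGaloisGroup (v.adicCompletion ℚ))] (n : ℕ)
    (a : continuousCohomology 1 (coindFin.{0, 0} (localRepOf (cofreeTorsionGaloisModule S ρ ((p ^ (k + 1) : ℕ) : ℤ)) v) (layerGroup κ v n)))
    (b : continuousCohomology 1 (coindFin.{0, 0} (localRepOf (cofreeTorsionGaloisModule S ρ ((p ^ k : ℕ) : ℤ)) v) (layerGroup κ v n))) :
    haveI : NeZero (p ^ k) := ⟨pow_ne_zero k (Fact.out : p.Prime).ne_zero⟩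
    haveI : NeZero (p ^ (k + 1)) := ⟨pow_ne_zero (k + 1) (Fact.out : p.Prime).ne_zero⟩
    cohomologyMap γ 2
        ((layerSumPairingOf (cofreeTorsionGaloisModule S ρ ((p ^ k : ℕ) : ℤ)) (p ^ k) (ePk k) (hμPk k) (hadd₁Pk k) (hadd₂Pk k) (hgalPk k)
            κ v n).cupProduct
          (cohomologyMap (coindFinMap (cofreeTorsionLocalPow S ρ k v) (layerGroup κ v n)) 1 a) b) =
      (layerSumPairingOf (cofreeTorsionGaloisModule S ρ ((p ^ (k + 1) : ℕ) : ℤ)) (p ^ (k + 1)) (ePk (k + 1)) (hμPk (k + 1))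
          (hadd₁Pk (k + 1)) (hadd₂Pk (k + 1)) (hgalPk (k + 1)) κ v n).cupProduct a
        (cohomologyMap (coindFinMap ((TopRep.ofHom (ι.hom.restrictField (v.adicCompletion ℚ)) :
          localRepOf (cofreeTorsionGaloisModule S ρ ((p ^ k : ℕ) : ℤ)) v ⟶ localRepOf (cofreeTorsionGaloisModule S ρ ((p ^ (k + 1) : ℕ) : ℤ)) v))
          (layerGroup κ v n)) 1 b) := by
  haveI : NeZero (p ^ k) := ⟨pow_ne_zero k (Fact.out : p.Prime).ne_zero⟩
  haveI : NeZero (p ^ (k + 1)) := ⟨pow_ne_zero (k + 1) (Fact.out : p.Prime).ne_zero⟩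
  letI : Fintype (absoluteGaloisGroup (v.adicCompletion ℚ) ⧸ layerGroup κ v n) := layerFintypeQuot κ v n
  unfold layerSumPairingOf
  exact ContPairing.cupProduct_coindFin_map_adjoint _ _ _ _ _ (layerGroup κ v n)
    (fun x y => incl_localPairingOfFun S ρ ePk hμPk hadd₁Pk hadd₂Pk hgalPk htower k ι hι v γ hγ x y) a b

/-! ## §3 The mixed projection formula for the layer pairings, value currency -/

set_option maxHeartbeats 400000 in
include htower hμPk hadd₂Pk hι hγ in
/-- **`(⟨[p]_* b', y⟩_{n,p^k}).val • p^{-k} = (⟨b', ι_* y⟩_{n,p^{k+1}}).val • p^{-(k+1)}`** for `b' ∈ H¹(U_n, A_ρ[p^{k+1}]|)`, `y ∈ H¹(U_n, A_ρ[p^k]|)`: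
Shapiro (`shapiroLift_cohomologyMap`), §2, §1. [cite: PerrinRiou1994Invent, §3.6.1] [cite: NeukirchSchmidtWingberg2008, I §4 (1.4.2), I §6 (1.6.4)]
[cite: SerreLocalFields1979, XIII §3] -/
theorem layerPairingH1Of_pow_incl_val_smul [CompactSpace (absoluteGaloisGroup (v.adicCompletion ℚ))] (n : ℕ)
    (b' : continuousCohomology 1 (subgroupRep (localRepOf (cofreeTorsionGaloisModule S ρ ((p ^ (k + 1) : ℕ) : ℤ)) v) (layerGroup κ v n)))
    (y : continuousCohomology 1 (subgroupRep (localRepOf (cofreeTorsionGaloisModule S ρ ((p ^ k : ℕ) : ℤ)) v) (layerGroup κ v n))) :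
    haveI : NeZero (p ^ k) := ⟨pow_ne_zero k (Fact.out : p.Prime).ne_zero⟩
    haveI : NeZero (p ^ (k + 1)) := ⟨pow_ne_zero (k + 1) (Fact.out : p.Prime).ne_zero⟩
    (layerPairingH1Of (cofreeTorsionGaloisModule S ρ ((p ^ k : ℕ) : ℤ)) (p ^ k) (ePk k) (hμPk k) (hadd₁Pk k) (hadd₂Pk k) (hgalPk k) κ v n
        (cohomologyMap (subgroupRepMap (cofreeTorsionLocalPow S ρ k v) (layerGroup κ v n)) 1 b') y).val •
        ((((p : ℚ) ^ k)⁻¹ : ℚ) : AddCircle (1 : ℚ)) =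
      (layerPairingH1Of (cofreeTorsionGaloisModule S ρ ((p ^ (k + 1) : ℕ) : ℤ)) (p ^ (k + 1)) (ePk (k + 1)) (hμPk (k + 1)) (hadd₁Pk (k + 1))
          (hadd₂Pk (k + 1)) (hgalPk (k + 1)) κ v n b'
        (cohomologyMap (subgroupRepMap (Y := localRepOf (cofreeTorsionGaloisModule S ρ ((p ^ (k + 1) : ℕ) : ℤ)) v)
          (TopRep.ofHom (ι.hom.restrictField (v.adicCompletion ℚ))) (layerGroup κ v n)) 1 y)).val •
        ((((p : ℚ) ^ (k + 1))⁻¹ : ℚ) : AddCircle (1 : ℚ)) := by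
  haveI : NeZero (p ^ k) := ⟨pow_ne_zero k (Fact.out : p.Prime).ne_zero⟩
  haveI : NeZero (p ^ (k + 1)) := ⟨pow_ne_zero (k + 1) (Fact.out : p.Prime).ne_zero⟩
  rw [layerPairingH1Of_apply, layerPairingH1Of_apply]
  unfold layerShapiroOf
  rw [shapiroLift_cohomologyMap, shapiroLift_cohomologyMap,
    ← cupProduct_layerSumPairingOf_incl S ρ ePk hμPk hadd₁Pk hadd₂Pk hgalPk htower k ι hι v γ hγ κ n,
    invAt_cohomologyMap_incl_val_smul v k γ hγ]

end Cup

end ThetaTransport.AwayTowerPow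

end Summit.BirchSwinnertonDyer.BirchSwinnertonDyer.Theorems

end
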